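import Mathlib
import HarnessLib
import Literature.Geometry.DiscreteGeometry.SphericalCodeHullEulerFormula
import Summits.AtomisticToContinuum.Crystallization.Theorems.PricedLinkCensusSoftFourRingsVertexBound
import Summits.AtomisticToContinuum.Crystallization.Theorems.PricedLinkCensusSoftFourRingsBondFacet

/-!
# Soft four-rings: bond triangles at a vertex (at most three; three form a fan)

Support file for `SoftFourRings` (route `PricedLinkCensus`, sub-problem `Crystallization`).

Setting: `X ⊂ S²` finite, pairwise `⟪·,·⟫ ≤ 1 − 1/(2·1.01²)`, `0 ∈ interior (conv X)`; a family `B`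
of *bond* pairs `{u, u'} ⊆ X` of close points (`⟪u, u'⟫ ≥ 1 − 1.01²/2`); a vertex `v ∈ X` whose
bonds are exactly `w 0, …, w 3`.  A *bond triangle at `v`* is a facet with three tight points, one
of them `v`, all of whose sides lie in `B`.

* `pair_mem_edgesOfFacet_of_card_three` — every pair of vertices of a triangular facet is a side;
* `tightSet_bondTriangle_at` — a bond triangle at `v` has tight set `{v, w i, w j}`, `{w i, w j} ∈ B`;
* `card_bondTriangles_at_le_three` — **`t_v ≤ 3`**;
* `exists_fan_of_three_bondTriangles_at` — **`t_v = 3` forces a three-fan**: after re-indexing,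
  `{w 0, w 1}, {w 1, w 2}, {w 2, w 3} ∈ B` and `{w 0, w 2}, {w 1, w 3}, {w 0, w 3} ∉ B`.
-/

namespace Summit.AtomisticToContinuum.Crystallization.Theorems

open Real RealInnerProductSpace Literature.Geometry.DiscreteGeometry

/-- A three-element `Finset` containing `v` is `{v, y, z}` for distinct `y, z ≠ v`. -/
theorem eq_three_of_mem {α : Type*} [DecidableEq α] {T : Finset α} {v : α} (hv : v ∈ T)
    (h3 : T.card = 3) : ∃ y z, y ≠ v ∧ z ≠ v ∧ y ≠ z ∧ T = {v, y, z} := by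
  have hns : ¬ (T ⊆ {v}) := fun h => by
    have := Finset.card_le_card h
    rw [h3, Finset.card_singleton] at this
    omega
  obtain ⟨y, hyT, hy⟩ := Finset.not_subset.1 hns
  rw [Finset.mem_singleton] at hy
  have hns' : ¬ (T ⊆ {v, y}) := fun h => by
    have := Finset.card_le_card h
    rw [h3, Finset.card_pair (Ne.symm hy)] at this
    omega
  obtain ⟨z, hzT, hz⟩ := Finset.not_subset.1 hns'
  rw [Finset.mem_insert, Finset.mem_singleton, not_or] at hz
  refine ⟨y, z, hy, hz.1, Ne.symm hz.2, ?_⟩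
  symm
  apply Finset.eq_of_subset_of_card_le
  · intro x hx
    rw [Finset.mem_insert, Finset.mem_insert, Finset.mem_singleton] at hx
    rcases hx with rfl | rfl | rfl
    exacts [hv, hyT, hzT]
  · rw [h3, Finset.card_eq_three.2 ⟨v, y, z, Ne.symm hy, Ne.symm hz.1, Ne.symm hz.2, rfl⟩]

/-- **Every pair of vertices of a triangular facet is a side** (a hull edge inside the facet). -/
theorem pair_mem_edgesOfFacet_of_card_three {X : Finset (EuclideanSpace ℝ (Fin 3))}
    (hX1 : ∀ y ∈ X, ‖y‖ = 1)
    (h0 : (0 : EuclideanSpace ℝ (Fin 3)) ∈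
      interior (convexHull ℝ (X : Set (EuclideanSpace ℝ (Fin 3)))))
    {c : EuclideanSpace ℝ (Fin 3)} (hcF : c ∈ facetNormals X) (h3 : (tightSet X c).card = 3)
    {p q : EuclideanSpace ℝ (Fin 3)} (hp : p ∈ tightSet X c) (hq : q ∈ tightSet X c)
    (hpq : p ≠ q) : ({p, q} : Finset (EuclideanSpace ℝ (Fin 3))) ∈ edgesOfFacet X c := by
  classical
  have hsub : edgesOfFacet X c ⊆ (tightSet X c).powersetCard 2 := by
    intro T hT
    unfold edgesOfFacet at hT
    rw [Finset.mem_filter] at hT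
    rw [Finset.mem_powersetCard]
    exact ⟨hT.2, card_eq_two_of_mem_hullEdges hT.1⟩
  have hcard : ((tightSet X c).powersetCard 2).card ≤ (edgesOfFacet X c).card := by
    rw [Finset.card_powersetCard, h3, card_edgesOfFacet hX1 h0 hcF, h3]
    decide
  rw [Finset.eq_of_subset_of_card_le hsub hcard, Finset.mem_powersetCard]
  refine ⟨?_, Finset.card_pair hpq⟩
  intro x hx
  rw [Finset.mem_insert, Finset.mem_singleton] at hx
  rcases hx with rfl | rfl
  exacts [hp, hq]

/-- The chord `{i, k}` is not an edge of the path `i – j – k – l`. -/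
theorem pair_ik_not_mem_path : ∀ i j k l : Fin 4, [i, j, k, l].Nodup →
    ({i, k} : Finset (Fin 4)) ∉ ({{i, j}, {j, k}, {k, l}} : Finset (Finset (Fin 4))) := by
  decide

/-- The chord `{j, l}` is not an edge of the path `i – j – k – l`. -/
theorem pair_jl_not_mem_path : ∀ i j k l : Fin 4, [i, j, k, l].Nodup →
    ({j, l} : Finset (Fin 4)) ∉ ({{i, j}, {j, k}, {k, l}} : Finset (Finset (Fin 4))) := by
  decide

/-- The chord `{i, l}` is not an edge of the path `i – j – k – l`. -/
theorem pair_il_not_mem_path : ∀ i j k l : Fin 4, [i, j, k, l].Nodup →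
    ({i, l} : Finset (Fin 4)) ∉ ({{i, j}, {j, k}, {k, l}} : Finset (Finset (Fin 4))) := by
  decide

section Bonds

variable {X : Finset (EuclideanSpace ℝ (Fin 3))} {B : Finset (Finset (EuclideanSpace ℝ (Fin 3)))}

/-- A bond pair consists of two close points of `X`. -/
theorem close_of_pair_mem_bonds
    (hB : ∀ T ∈ B, ∃ u ∈ X, ∃ u' ∈ X, u ≠ u' ∧ 1 - (101 / 100 : ℝ) ^ 2 / 2 ≤ ⟪u, u'⟫ ∧ T = {u, u'})
    {a b : EuclideanSpace ℝ (Fin 3)} (hab : ({a, b} : Finset (EuclideanSpace ℝ (Fin 3))) ∈ B)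
    (hne : a ≠ b) : a ∈ X ∧ b ∈ X ∧ 1 - (101 / 100 : ℝ) ^ 2 / 2 ≤ ⟪a, b⟫ := by
  obtain ⟨u, hu, u', hu', -, hclose, hT⟩ := hB _ hab
  have ha : a ∈ ({u, u'} : Finset (EuclideanSpace ℝ (Fin 3))) := by
    rw [← hT]; exact Finset.mem_insert_self _ _
  have hb : b ∈ ({u, u'} : Finset (EuclideanSpace ℝ (Fin 3))) := by
    rw [← hT]; exact Finset.mem_insert_of_mem (Finset.mem_singleton_self _)
  rw [Finset.mem_insert, Finset.mem_singleton] at ha hb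
  rcases ha with rfl | rfl <;> rcases hb with rfl | rfl
  · exact absurd rfl hne
  · exact ⟨hu, hu', hclose⟩
  · exact ⟨hu', hu, by rw [real_inner_comm]; exact hclose⟩
  · exact absurd rfl hne

variable (hX1 : ∀ y ∈ X, ‖y‖ = 1)
  (h0 : (0 : EuclideanSpace ℝ (Fin 3)) ∈
    interior (convexHull ℝ (X : Set (EuclideanSpace ℝ (Fin 3)))))
  (hsepX : ∀ u ∈ X, ∀ u' ∈ X, u ≠ u' → ⟪u, u'⟫ ≤ 1 - 1 / (2 * (101 / 100 : ℝ) ^ 2))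
  (hB : ∀ T ∈ B, ∃ u ∈ X, ∃ u' ∈ X, u ≠ u' ∧ 1 - (101 / 100 : ℝ) ^ 2 / 2 ≤ ⟪u, u'⟫ ∧ T = {u, u'})
  {v : EuclideanSpace ℝ (Fin 3)} (hv : v ∈ X) (w : Fin 4 → EuclideanSpace ℝ (Fin 3))
  (hwX : ∀ k, w k ∈ X) (hwinj : Function.Injective w) (hwv : ∀ k, w k ≠ v)
  (hvw : ∀ k, ({v, w k} : Finset (EuclideanSpace ℝ (Fin 3))) ∈ B)
  (hvonly : ∀ y, ({v, y} : Finset (EuclideanSpace ℝ (Fin 3))) ∈ B → ∃ k, y = w k)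

include hX1 h0 hvonly in
/-- **A bond triangle at `v` is `{v, w i, w j}` with `{w i, w j} ∈ B`.** -/
theorem tightSet_bondTriangle_at {c : EuclideanSpace ℝ (Fin 3)} (hcF : c ∈ facetNormals X)
    (h3 : (tightSet X c).card = 3)
    (hnb : ((edgesOfFacet X c).filter (fun T => T ∉ B)).card = 0) (hvc : v ∈ tightSet X c) :
    ∃ i j, i ≠ j ∧ tightSet X c = {v, w i, w j} ∧
      ({w i, w j} : Finset (EuclideanSpace ℝ (Fin 3))) ∈ B := by
  classical
  obtain ⟨y, z, hyv, hzv, hyz, hT⟩ := eq_three_of_mem hvc h3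
  have hall : ∀ T ∈ edgesOfFacet X c, T ∈ B := by
    intro T hT
    by_contra hTB
    have : T ∈ (edgesOfFacet X c).filter (fun T => T ∉ B) := Finset.mem_filter.2 ⟨hT, hTB⟩
    rw [Finset.card_eq_zero.1 hnb] at this
    exact Finset.notMem_empty _ this
  have hyc : y ∈ tightSet X c := by rw [hT]; simp
  have hzc : z ∈ tightSet X c := by rw [hT]; simp
  have hvy : ({v, y} : Finset (EuclideanSpace ℝ (Fin 3))) ∈ B :=
    hall _ (pair_mem_edgesOfFacet_of_card_three hX1 h0 hcF h3 hvc hyc hyv.symm)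
  have hvz : ({v, z} : Finset (EuclideanSpace ℝ (Fin 3))) ∈ B :=
    hall _ (pair_mem_edgesOfFacet_of_card_three hX1 h0 hcF h3 hvc hzc hzv.symm)
  have hyzB : ({y, z} : Finset (EuclideanSpace ℝ (Fin 3))) ∈ B :=
    hall _ (pair_mem_edgesOfFacet_of_card_three hX1 h0 hcF h3 hyc hzc hyz)
  obtain ⟨i, rfl⟩ := hvonly y hvy
  obtain ⟨j, rfl⟩ := hvonly z hvz
  exact ⟨i, j, fun h => hyz (by rw [h]), hT, hyzB⟩

include hwinj hwv in
/-- The indices of the link points inside `{v, w i, w j}` are `{i, j}`. -/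
theorem filter_mem_three_eq (i j : Fin 4) :
    (Finset.univ : Finset (Fin 4)).filter
        (fun k => w k ∈ ({v, w i, w j} : Finset (EuclideanSpace ℝ (Fin 3)))) = {i, j} := by
  ext k
  simp only [Finset.mem_filter, Finset.mem_univ, true_and, Finset.mem_insert,
    Finset.mem_singleton]
  constructor
  · rintro (h | h | h)
    · exact absurd h (hwv k)
    · exact Or.inl (hwinj h)
    · exact Or.inr (hwinj h)
  · rintro (rfl | rfl)
    · exact Or.inr (Or.inl rfl)
    · exact Or.inr (Or.inr rfl)

include hX1 hsepX hB hv hwX hwinj hwv hvw in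
open scoped Classical in
/-- **A bond pair in the link spans a bond triangle at `v`**: if `{w i, w j} ∈ B` then the facet
`{v, w i, w j}` exists and all its sides lie in `B`. -/
theorem bondTriangle_at_of_mem_bonds {i j : Fin 4} (hij : i ≠ j)
    (hBij : ({w i, w j} : Finset (EuclideanSpace ℝ (Fin 3))) ∈ B) :
    ∃ c ∈ facetNormals X, tightSet X c = {v, w i, w j} ∧
      ((edgesOfFacet X c).filter (fun T => T ∉ B)).card = 0 := by
  have hvw' : ∀ k, (1 - (101 / 100 : ℝ) ^ 2 / 2) ≤ ⟪v, w k⟫ := fun k =>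
    (close_of_pair_mem_bonds hB (hvw k) (hwv k).symm).2.2
  have hcl := (close_of_pair_mem_bonds hB hBij (fun h => hij (hwinj h))).2.2
  obtain ⟨c, hcF, hcT, -, -⟩ := bond_triangle_facet_one_percent hX1 hsepX hv (hwX i) (hwX j)
    (hwv i).symm (hwv j).symm (fun h => hij (hwinj h)) (hvw' i) (hvw' j) hcl
  refine ⟨c, hcF, hcT, ?_⟩
  rw [Finset.card_eq_zero, Finset.filter_eq_empty_iff]
  intro T hT
  rw [not_not]
  unfold edgesOfFacet at hT
  obtain ⟨hTH, hTsub⟩ := Finset.mem_filter.1 hT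
  rw [hcT] at hTsub
  obtain ⟨p, q, hpq, rfl⟩ := Finset.card_eq_two.1 (card_eq_two_of_mem_hullEdges hTH)
  have hp : p ∈ ({v, w i, w j} : Finset (EuclideanSpace ℝ (Fin 3))) :=
    hTsub (Finset.mem_insert_self _ _)
  have hq : q ∈ ({v, w i, w j} : Finset (EuclideanSpace ℝ (Fin 3))) :=
    hTsub (Finset.mem_insert_of_mem (Finset.mem_singleton_self _))
  rw [Finset.mem_insert, Finset.mem_insert, Finset.mem_singleton] at hp hq
  rcases hp with rfl | rfl | rfl <;> rcases hq with rfl | rfl | rfl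
  · exact absurd rfl hpq
  · exact hvw i
  · exact hvw j
  · rw [Finset.pair_comm]; exact hvw i
  · exact absurd rfl hpq
  · exact hBij
  · rw [Finset.pair_comm]; exact hvw j
  · rw [Finset.pair_comm]; exact hBij
  · exact absurd rfl hpq

include hX1 h0 hsepX hB hv hwX hwinj hwv hvw hvonly in
open scoped Classical in
/-- **At most three bond triangles at a vertex** (`t_v ≤ 3`): the bond triangles at `v` inject
into the close index pairs of the link `w`, of which there are at most three
(`card_close_pairs_le_three`). -/
theorem card_bondTriangles_at_le_three :
    ((facetNormals X).filter (fun c => v ∈ tightSet X c ∧ (tightSet X c).card = 3 ∧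
      ((edgesOfFacet X c).filter (fun T => T ∉ B)).card = 0)).card ≤ 3 := by
  set S₀ := (facetNormals X).filter (fun c => v ∈ tightSet X c ∧ (tightSet X c).card = 3 ∧
      ((edgesOfFacet X c).filter (fun T => T ∉ B)).card = 0) with hS₀
  set g : EuclideanSpace ℝ (Fin 3) → Finset (Fin 4) :=
    fun c => (Finset.univ : Finset (Fin 4)).filter (fun k => w k ∈ tightSet X c) with hg
  -- description of `g` and of the tight sets on `S₀`
  have key : ∀ c ∈ S₀, ∃ i j, i ≠ j ∧ tightSet X c = {v, w i, w j} ∧ g c = {i, j} ∧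
      ({w i, w j} : Finset (EuclideanSpace ℝ (Fin 3))) ∈ B := by
    intro c hc
    obtain ⟨hcF, hvc, h3, hnb⟩ := Finset.mem_filter.1 hc
    obtain ⟨i, j, hij, hT, hB'⟩ := tightSet_bondTriangle_at hX1 h0 w hvonly hcF h3 hnb hvc
    refine ⟨i, j, hij, hT, ?_, hB'⟩
    show (Finset.univ : Finset (Fin 4)).filter (fun k => w k ∈ tightSet X c) = {i, j}
    rw [hT]
    exact filter_mem_three_eq w hwinj hwv i j
  have htight : ∀ c ∈ S₀, tightSet X c = insert v ((g c).image w) := by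
    intro c hc
    obtain ⟨i, j, -, hT, hgc, -⟩ := key c hc
    rw [hT, hgc, Finset.image_insert, Finset.image_singleton]
  have hinj : Set.InjOn g S₀ := by
    intro c hc c' hc' h
    have hc1 := htight c hc
    have hc2 := htight c' hc'
    rw [h, ← hc2] at hc1
    exact (mem_facetNormals.1 (Finset.mem_filter.1 hc).1).eq_of_tightSet_eq hc1
  rw [← Finset.card_image_of_injOn hinj]
  -- the image is a set of close index pairs
  have hvw' : ∀ k, (1 - (101 / 100 : ℝ) ^ 2 / 2) ≤ ⟪v, w k⟫ ∧
      ⟪v, w k⟫ ≤ 1 - 1 / (2 * (101 / 100 : ℝ) ^ 2) := fun k =>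
    ⟨(close_of_pair_mem_bonds hB (hvw k) (hwv k).symm).2.2, hsepX v hv (w k) (hwX k) (hwv k).symm⟩
  have hsep : ∀ i j, i ≠ j → ⟪w i, w j⟫ ≤ 1 - 1 / (2 * (101 / 100 : ℝ) ^ 2) :=
    fun i j hij => hsepX (w i) (hwX i) (w j) (hwX j) (fun h => hij (hwinj h))
  refine card_close_pairs_le_three (hX1 v hv) (fun k => hX1 _ (hwX k)) hvw' hsep ?_ ?_
  · intro P hP
    obtain ⟨c, hc, rfl⟩ := Finset.mem_image.1 hP
    obtain ⟨i, j, hij, -, hgc, -⟩ := key c hc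
    rw [hgc, Finset.card_pair hij]
  · intro i j hij'
    obtain ⟨c, hc, hgc'⟩ := Finset.mem_image.1 hij'
    obtain ⟨i', j', hi'j', -, hgc, hB'⟩ := key c hc
    by_cases hij : i = j
    · subst hij
      rw [real_inner_self_eq_norm_sq, hX1 _ (hwX i)]
      norm_num
    · have hpair : ({w i, w j} : Finset (EuclideanSpace ℝ (Fin 3))) = {w i', w j'} := by
        have : ({i, j} : Finset (Fin 4)) = {i', j'} := by rw [← hgc', hgc]
        rw [← Finset.image_singleton w j, ← Finset.image_insert, this, Finset.image_insert,
          Finset.image_singleton]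
      rw [← hpair] at hB'
      exact (close_of_pair_mem_bonds hB hB' (fun h => hij (hwinj h))).2.2

include hX1 h0 hsepX hB hv hwX hwinj hwv hvw hvonly in
open scoped Classical in
/-- **Three bond triangles at a vertex form a three-fan.**  If `t_v = 3` then, for an
enumeration `i, j, k, l` of the indices, `{w i, w j}, {w j, w k}, {w k, w l} ∈ B` are the close
index pairs and `{w i, w k}, {w j, w l}, {w i, w l} ∉ B`. -/
theorem exists_fan_of_three_bondTriangles_at
    (h3 : ((facetNormals X).filter (fun c => v ∈ tightSet X c ∧ (tightSet X c).card = 3 ∧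
      ((edgesOfFacet X c).filter (fun T => T ∉ B)).card = 0)).card = 3) :
    ∃ i j k l : Fin 4, i ≠ j ∧ i ≠ k ∧ i ≠ l ∧ j ≠ k ∧ j ≠ l ∧ k ≠ l ∧
      ({w i, w j} : Finset (EuclideanSpace ℝ (Fin 3))) ∈ B ∧
      ({w j, w k} : Finset (EuclideanSpace ℝ (Fin 3))) ∈ B ∧
      ({w k, w l} : Finset (EuclideanSpace ℝ (Fin 3))) ∈ B ∧
      ({w i, w k} : Finset (EuclideanSpace ℝ (Fin 3))) ∉ B ∧
      ({w j, w l} : Finset (EuclideanSpace ℝ (Fin 3))) ∉ B ∧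
      ({w i, w l} : Finset (EuclideanSpace ℝ (Fin 3))) ∉ B := by
  set S₀ := (facetNormals X).filter (fun c => v ∈ tightSet X c ∧ (tightSet X c).card = 3 ∧
      ((edgesOfFacet X c).filter (fun T => T ∉ B)).card = 0) with hS₀
  set g : EuclideanSpace ℝ (Fin 3) → Finset (Fin 4) :=
    fun c => (Finset.univ : Finset (Fin 4)).filter (fun k => w k ∈ tightSet X c) with hg
  have key : ∀ c ∈ S₀, ∃ i j, i ≠ j ∧ tightSet X c = {v, w i, w j} ∧ g c = {i, j} ∧
      ({w i, w j} : Finset (EuclideanSpace ℝ (Fin 3))) ∈ B := by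
    intro c hc
    obtain ⟨hcF, hvc, h3, hnb⟩ := Finset.mem_filter.1 hc
    obtain ⟨i, j, hij, hT, hB'⟩ := tightSet_bondTriangle_at hX1 h0 w hvonly hcF h3 hnb hvc
    refine ⟨i, j, hij, hT, ?_, hB'⟩
    show (Finset.univ : Finset (Fin 4)).filter (fun k => w k ∈ tightSet X c) = {i, j}
    rw [hT]
    exact filter_mem_three_eq w hwinj hwv i j
  have htight : ∀ c ∈ S₀, tightSet X c = insert v ((g c).image w) := by
    intro c hc
    obtain ⟨i, j, -, hT, hgc, -⟩ := key c hc
    rw [hT, hgc, Finset.image_insert, Finset.image_singleton]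
  have hinj : Set.InjOn g S₀ := by
    intro c hc c' hc' h
    have hc1 := htight c hc
    have hc2 := htight c' hc'
    rw [h, ← hc2] at hc1
    exact (mem_facetNormals.1 (Finset.mem_filter.1 hc).1).eq_of_tightSet_eq hc1
  have hcard : (S₀.image g).card = 3 := by rw [Finset.card_image_of_injOn hinj]; exact h3
  have hvw' : ∀ k, (1 - (101 / 100 : ℝ) ^ 2 / 2) ≤ ⟪v, w k⟫ ∧
      ⟪v, w k⟫ ≤ 1 - 1 / (2 * (101 / 100 : ℝ) ^ 2) := fun k =>
    ⟨(close_of_pair_mem_bonds hB (hvw k) (hwv k).symm).2.2, hsepX v hv (w k) (hwX k) (hwv k).symm⟩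
  have hsep : ∀ i j, i ≠ j → ⟪w i, w j⟫ ≤ 1 - 1 / (2 * (101 / 100 : ℝ) ^ 2) :=
    fun i j hij => hsepX (w i) (hwX i) (w j) (hwX j) (fun h => hij (hwinj h))
  -- membership in the image `↔` bond pair
  have hmemB : ∀ i j, i ≠ j → (({i, j} : Finset (Fin 4)) ∈ S₀.image g ↔
      ({w i, w j} : Finset (EuclideanSpace ℝ (Fin 3))) ∈ B) := by
    intro i j hij
    constructor
    · intro hm
      obtain ⟨c, hc, hgc'⟩ := Finset.mem_image.1 hm
      obtain ⟨i', j', -, -, hgc, hB'⟩ := key c hc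
      have hpair : ({w i, w j} : Finset (EuclideanSpace ℝ (Fin 3))) = {w i', w j'} := by
        have : ({i, j} : Finset (Fin 4)) = {i', j'} := by rw [← hgc', hgc]
        rw [← Finset.image_singleton w j, ← Finset.image_insert, this, Finset.image_insert,
          Finset.image_singleton]
      rw [hpair]; exact hB'
    · intro hBij
      obtain ⟨c, hcF, hcT, hnb⟩ := bondTriangle_at_of_mem_bonds hX1 hsepX hB hv w hwX hwinj hwv hvw
        hij hBij
      have h3c : (tightSet X c).card = 3 := by
        rw [hcT]; exact Finset.card_eq_three.2 ⟨v, w i, w j, (hwv i).symm, (hwv j).symm,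
          fun h => hij (hwinj h), rfl⟩
      have hvc : v ∈ tightSet X c := by rw [hcT]; exact Finset.mem_insert_self _ _
      have hc : c ∈ S₀ := Finset.mem_filter.2 ⟨hcF, hvc, h3c, hnb⟩
      have hgc : g c = {i, j} := by
        show (Finset.univ : Finset (Fin 4)).filter (fun k => w k ∈ tightSet X c) = {i, j}
        rw [hcT]; exact filter_mem_three_eq w hwinj hwv i j
      exact Finset.mem_image.2 ⟨c, hc, hgc⟩
  -- apply the combinatorial fan lemma
  obtain ⟨i, j, k, l, hij, hik, hil, hjk, hjl, hkl, hS⟩ :=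
    exists_fan_of_card_close_pairs_eq_three (hX1 v hv) (fun k => hX1 _ (hwX k)) hvw' hsep
      (S := S₀.image g) (fun P hP => by
        obtain ⟨c, hc, rfl⟩ := Finset.mem_image.1 hP
        obtain ⟨i, j, hij, -, hgc, -⟩ := key c hc
        rw [hgc, Finset.card_pair hij])
      (fun i j hm => by
        by_cases hij : i = j
        · subst hij
          rw [real_inner_self_eq_norm_sq, hX1 _ (hwX i)]
          norm_num
        · exact (close_of_pair_mem_bonds hB ((hmemB i j hij).1 hm)
            (fun h => hij (hwinj h))).2.2)
      hcard
  refine ⟨i, j, k, l, hij, hik, hil, hjk, hjl, hkl, ?_, ?_, ?_, ?_, ?_, ?_⟩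
  · exact (hmemB i j hij).1 (by rw [hS]; simp)
  · exact (hmemB j k hjk).1 (by rw [hS]; simp)
  · exact (hmemB k l hkl).1 (by rw [hS]; simp)
  · intro h
    have := (hmemB i k hik).2 h
    rw [hS] at this
    exact pair_ik_not_mem_path i j k l (by simp [hij, hik, hil, hjk, hjl, hkl]) this
  · intro h
    have := (hmemB j l hjl).2 h
    rw [hS] at this
    exact pair_jl_not_mem_path i j k l (by simp [hij, hik, hil, hjk, hjl, hkl]) this
  · intro h
    have := (hmemB i l hil).2 h
    rw [hS] at this
    exact pair_il_not_mem_path i j k l (by simp [hij, hik, hil, hjk, hjl, hkl]) this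

end Bonds

end Summit.AtomisticToContinuum.Crystallization.Theorems
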